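import Summits.HodgeConjecture.CorCM.OcticWeilOrbitHodgeOfMarkman
import Summits.HodgeConjecture.CorCM.QuarticCMTypeSlice
import Summits.HodgeConjecture.CorCM.AndreRiemannBiproducts
import Summits.HodgeConjecture.CorCM.Model.CMAbelianVarietyRealisedHolds
import Literature.AlgebraicGeometry.ComplexMultiplication.ShimuraIsogenyHolds
import HarnessLib

/-!
# COR-CM — the Hodge conjecture for EVERY PRODUCT OF CM ABELIAN FOURFOLDS OF WEIL TYPE OVER ONE OCTIC CM FIELD (all
# `(2,2)`-types, one simple member) and powers of the CM curve of `k`, GIVEN ONLY Markman's fourfold theorem: the FAMILY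
# form — all products of the Galois conjugates of a degenerate simple CM fourfold, with no choice of representatives

Cell `pub-hodgecm2` (COR-CM), seat b30 gen 20 (2026-08-22); count-neutral own lane OCTIC-WEIL-ORBIT — intrinsic capstone.
Theorems only; no definition, no `sorry`; displayed named fact: `Markman2025_weilClasses_algebraic_abelianFourfold`
(unrefereed); consumed unconditional tree theorems: `cmAbelianVarietyRealised_holds` (Shimura §6.2 Thm. 3: every CM type is
realised) and `Shimura1998_Thm2_Cor_holds` (any two realisations of one CM type are isogenous).

THE STATEMENT (`hodgeConjectureFor_family_of_isSimple_of_markman`).  `K` ANY CM field of degree `8`, `k` imaginary quadratic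
with `i : k → K`, `τ : k → ℂ`; a finite family `A_j ⊨ (K; Φ_j)` (`j < n`) of CM abelian fourfolds ALL of `k`-signature `(2,2)`
(`#{s ∈ Φ_j | s ∘ i = τ} = 2`), at least one of them SIMPLE; `E ⊨ (k; Ψ ∋ τ)`.  Then the Hodge conjecture holds for
`E^a × ∏_j A_j` for every `a`, and for everything dominated by it.  In words: **every product of Galois conjugates `σB` of a
degenerate simple CM fourfold `B` (Weil type, Dodson's `ℤ₂ × A₄ / ℤ₂ × S₄` fields) — with any multiplicities and any CM
structures — times any power of the CM curve of `k`, satisfies the Hodge conjecture modulo Markman's fourfold theorem.**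
(The `(2,2)`-types of `(K, i, τ)` are the six `Φ_J`, `J` a `2`-subset of the conjugate pairs over `τ`; `σΦ_j` runs through
all of them; no general-position hypothesis is needed here.)

THE PROOF.  Let `B₁ = A_{j₀}` be simple.  A frame `e` of `Φ_{j₀}` (gen 19's `exists_frame₂`: `Φ_{j₀}` reads as `I_0 = {0,1}`)
carries two further frame-read types `I_1, I_2` (`exists_cmType_of_frame`), realised by `B₂, B₃`
(`cmAbelianVarietyRealised_holds`); the three are in general position (`counts_of_frame`), so the vec theorem of
`CorCM/OcticWeilOrbitHodgeOfMarkman.lean` gives the Hodge conjecture for every `⨁_l ![E, B₁, B₂, B₃] (κ l)`.  Every `(2,2)`-type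
`Φ_j` reads in `e` as some `I_m` or its conjugate (`exists_slot_reading`: a `2`-subset of `Fin 4` is `{0, m+1}` or its
complement), so `A_j` — after passing to the conjugate CM structure if needed — realises the type of `B_m` and is ISOGENOUS to
it (Shimura), hence dominated by it (`avDominatedBy_of_readings`); domination passes to `E^a × ∏_j A_j` factor by factor
(`Domination.AVDominatedBy.biproduct_map`, `AndreRiemann.avDominatedBy_prod_of_biproduct`, reindexing `Fin a ⊕ Fin n ≃ Fin (a+n)`).
HONEST FRAMING: conditional on the displayed Markman binder; nothing here asserts `HC_CM`.

## References
* [Markman2025SurveySecant] E. Markman, arXiv:2509.23403 (2025), Thm. 1.2 and §1.1.  [Dodson1984] B. Dodson, Trans. AMS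
  283 (1984), §3.3.2 Theorem.  [Shimura1998] G. Shimura, *Abelian varieties with complex multiplication and modular
  functions*, §6.1 Thm. 2 Cor., §6.2 Thm. 3, §8.2 Prop. 26.  [Deligne1982HodgeCycles] P. Deligne, LNM 900 (1982), §5 (b).
  [Pohlmann1968] H. Pohlmann, Ann. of Math. 88 (1968), Thm 1, §3.  [MumfordAV1970] D. Mumford, *Abelian Varieties*, §19.
-/

noncomputable section

open CategoryTheory CategoryTheory.Limits NumberField

namespace Summit.HodgeConjecture.CorCM.OcticWeilOrbit

open Literature.AlgebraicGeometry Literature.AlgebraicGeometry.Motives Literature.AlgebraicGeometry.HodgeTheory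
open Literature.AlgebraicGeometry.ComplexMultiplication (IsCMTypeRealisation Shimura1998_Thm2_Cor_holds)
open Literature.AlgebraicGeometry.Pohlmann1968
open Literature.AlgebraicTopology.SingularHomology
open Literature.NumberTheory.ComplexMultiplication
open Summit.HodgeConjecture.CorCM.Census.OcticWeilOrbit (signTab)
open Summit.HodgeConjecture.CorCM.Census.OcticWeilFourfold (phi₂)
open Summit.HodgeConjecture.CorCM.OcticWeilFourfold (exists_frame₂ twoTransitive_of_isSimple)
open Summit.HodgeConjecture.CorCM.Domination (AVDominatedBy)
open Summit.HodgeConjecture.CorCM.AndreRiemann (sumFam avDominatedBy_prod_of_biproduct avDominatedBy_biproduct_reindex)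

open scoped Classical

/-! ## §1 Frame-read types: the star `I_0, I_1, I_2`, its counts, and the classification of `(2,2)`-types -/

section Frame

/-- gen 19's type `phi₂` of the 10-point model is the straight reading of `I_0 = {0, 1}`:
`inr p ∈ phi₂ ⟺ p.2 = signTab 0 0 p.1`. [folklore] -/
theorem inr_mem_phi₂_iff_signTab : ∀ p : Fin 4 × Bool, Sum.inr p ∈ phi₂ ↔ p.2 = signTab 0 0 p.1 := by
  unfold phi₂ Census.OcticWeilFourfold.phi₂Pre signTab
  decide

/-- The finite counts of the star: `|I_m| = 2` and `|I_m ∩ I_{m'}| = 1` for `m ≠ m'`, on the labels over `τ`. [folklore] -/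
theorem card_filter_signTab :
    (∀ m : Fin 3, ((Finset.univ : Finset (Fin 4)).filter fun a => true = signTab 0 m a).card = 2) ∧
    ∀ m m' : Fin 3, m ≠ m' →
      ((Finset.univ : Finset (Fin 4)).filter fun a => true = signTab 0 m a ∧ true = signTab 0 m' a).card = 1 := by
  unfold signTab
  refine ⟨by decide, by decide⟩

/-- **Classification of the `2`-subsets of the pairs**: every `2`-subset of `Fin 4` is `I_m = {0, m+1}` or its complement —
`a ∈ T ⟺ [a ∈ I_m] = ¬f` for some `m < 3`, `f : Bool`. [folklore] -/
theorem exists_slot_of_pair : ∀ T : Finset (Fin 4), T.card = 2 →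
    ∃ m : Fin 3, ∃ f : Bool, ∀ a : Fin 4, a ∈ T ↔ signTab 0 m a = !f := by
  unfold signTab
  decide +kernel

variable {L : Type} [Field L]

/-- **A frame-read `(2,2)`-type**: for a frame `e` with `e s̄ = ((e s).1, ¬(e s).2)`, the set `{s | (e s).2 = [(e s).1 ∈ I_m]}`
is a CM type (exactly one of `s, s̄`). [cite: Deligne1982HodgeCycles, §5 (S = Φ ⊔ ιΦ)] -/
theorem exists_cmType_of_frame {e : (L →+* ℂ) ≃ Fin 4 × Bool}
    (he_conj : ∀ s, e (ComplexEmbedding.conjugate s) = ((e s).1, !(e s).2)) (m : Fin 3) :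
    ∃ Φ : CMType L, ∀ s, s ∈ Φ.1 ↔ (e s).2 = signTab 0 m (e s).1 :=
  ⟨⟨{s | (e s).2 = signTab 0 m (e s).1}, fun s => by
    simp only [Set.mem_setOf_eq, he_conj]
    cases (e s).2 <;> cases signTab 0 m (e s).1 <;> decide⟩, fun _ => Iff.rfl⟩

variable {l : Type} [Field l] [Fintype (L →+* ℂ)] {e : (L →+* ℂ) ≃ Fin 4 × Bool} {i : l →+* L} {τ : l →+* ℂ}

/-- Counts of frame-read types over `τ`: `#{s | s ∘ i = τ ∧ s ∈ Φ} = 2` and, for two of them with `m ≠ m'`,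
`#{s | s ∘ i = τ ∧ s ∈ Φ ∧ s ∈ Φ'} = 1` (the star counts, through `card_filter_symm_true`). [folklore] -/
theorem counts_of_frame (he_sign : ∀ s, (e s).2 = true ↔ s.comp i = τ) {m m' : Fin 3} (hmm' : m ≠ m')
    {Φ Φ' : CMType L} (hΦ : ∀ s, s ∈ Φ.1 ↔ (e s).2 = signTab 0 m (e s).1)
    (hΦ' : ∀ s, s ∈ Φ'.1 ↔ (e s).2 = signTab 0 m' (e s).1) :
    (Finset.univ.filter fun s : L →+* ℂ => s.comp i = τ ∧ s ∈ Φ.1).card = 2 ∧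
      (Finset.univ.filter fun s : L →+* ℂ => s.comp i = τ ∧ (s ∈ Φ.1 ∧ s ∈ Φ'.1)).card = 1 := by
  have hread : ∀ (n : Fin 3) (Ψ : CMType L), (∀ s, s ∈ Ψ.1 ↔ (e s).2 = signTab 0 n (e s).1) →
      ∀ a : Fin 4, e.symm (a, true) ∈ Ψ.1 ↔ true = signTab 0 n a := fun n Ψ hΨ a => by
    rw [hΨ, Equiv.apply_symm_apply]
  constructor
  · rw [← card_filter_symm_true he_sign (fun s => s ∈ Φ.1), Finset.filter_congr fun a _ => hread m Φ hΦ a]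
    exact card_filter_signTab.1 m
  · rw [← card_filter_symm_true he_sign (fun s => s ∈ Φ.1 ∧ s ∈ Φ'.1),
      Finset.filter_congr fun a _ => (hread m Φ hΦ a).and (hread m' Φ' hΦ' a)]
    exact card_filter_signTab.2 m m' hmm'

/-- **Classification of the `(2,2)`-types in a frame**: a CM type `Φ` with two members over `τ` reads as `I_m` or as its
conjugate for some `m < 3`: `s ∈ Φ ⟺ [(e s).1 ∈ I_m] = ((e s).2 ≠ f)`. [cite: Dodson1984, §3.1.1] [cite: Shimura1998, §18.2] -/
theorem exists_slot_reading (he_sign : ∀ s, (e s).2 = true ↔ s.comp i = τ)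
    (he_conj : ∀ s, e (ComplexEmbedding.conjugate s) = ((e s).1, !(e s).2)) (Φ : CMType L)
    (h22 : (Finset.univ.filter fun s : L →+* ℂ => s.comp i = τ ∧ s ∈ Φ.1).card = 2) :
    ∃ (m : Fin 3) (f : Bool), ∀ s, s ∈ Φ.1 ↔ signTab 0 m (e s).1 = ((e s).2 != f) := by
  obtain ⟨m, f, hmf⟩ := exists_slot_of_pair (Finset.univ.filter fun a : Fin 4 => e.symm (a, true) ∈ Φ.1)
    (by rw [card_filter_symm_true he_sign (fun s => s ∈ Φ.1)]; exact h22)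
  exact ⟨m, f, mem_iff_of_reading_true he_conj fun a => by rw [← hmf a]; simp⟩

end Frame

/-! ## §2 Same reading ⇒ isogenous ⇒ dominated (Shimura) -/

section Isogeny

variable {K : Type} [Field K] [NumberField K] [IsCMField K]

/-- **Same reading, same type, isogenous, dominated.**  If `A ⊨ (K; Φ)` reads in a frame `e` as `I_m` up to conjugation and
`B ⊨ (K; Φ_B)` reads as `I_m` straight, then `A` is dominated by `B`: after passing to the conjugate CM structure on `A` if
needed (`exists_realisation_of_reading`) both realise THE SAME CM type, so Shimura's corollary (tree theorem
`Shimura1998_Thm2_Cor_holds`) gives an isogeny `A → B`. [cite: Shimura1998, §6.1 Thm. 2 Cor.] [cite: Deligne1982HodgeCycles, §5 (b)]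
[cite: MumfordAV1970, §19] -/
theorem avDominatedBy_of_readings {e : (K →+* ℂ) ≃ Fin 4 × Bool}
    (he_conj : ∀ s, e (ComplexEmbedding.conjugate s) = ((e s).1, !(e s).2)) {m : Fin 3} {f : Bool} {Φ ΦB : CMType K}
    (hread : ∀ s, s ∈ Φ.1 ↔ signTab 0 m (e s).1 = ((e s).2 != f))
    (hreadB : ∀ s, s ∈ ΦB.1 ↔ (e s).2 = signTab 0 m (e s).1)
    {A : AbelianVariety ℂ} {ι : 𝓞 K →+* End A} {θ : K →+* Module.End ℂ (complexBetti A.X 1)}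
    (hA : IsCMTypeRealisation Φ A ι θ)
    {B : AbelianVariety ℂ} {ιB : 𝓞 K →+* End B} {θB : K →+* Module.End ℂ (complexBetti B.X 1)}
    (hB : IsCMTypeRealisation ΦB B ιB θB) : AVDominatedBy A B := by
  obtain ⟨Φ', ι', θ', hA', hΦ'⟩ := exists_realisation_of_reading he_conj hread hA
  have hΦΦ : Φ' = ΦB := Subtype.ext (Set.ext fun s => (hΦ' s).trans (hreadB s).symm)
  subst hΦΦ
  obtain ⟨g, hg, -⟩ := Shimura1998_Thm2_Cor_holds K Φ' A ι' θ' B ιB θB hA' hB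
  exact AVDominatedBy.of_isIsogeny_hom hg (AVDominatedBy.refl B)

end Isogeny

/-! ## §3 The family theorem -/

section Main

variable {K : Type} [Field K] [NumberField K] [IsCMField K] {k : Type} [Field k] [NumberField k] [IsCMField k] {n : ℕ}
  {A : Fin n → AbelianVariety ℂ} {Φ : Fin n → CMType K} {ι : ∀ j, 𝓞 K →+* End (A j)}
  {θ : ∀ j, K →+* Module.End ℂ (complexBetti (A j).X 1)}
  {Ψ : CMType k} {E : AbelianVariety ℂ} {ιE : 𝓞 k →+* End E} {θE : k →+* Module.End ℂ (complexBetti E.X 1)}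

/-- **The family form under `2`-TRANSITIVITY.**  `K` ANY CM field of degree `8`, `k` imaginary quadratic, `i : k → K`,
`τ : k → ℂ`; `A_j ⊨ (K; Φ_j)` (`j < n`, `n ≥ 1` witnessed by `j₀`) CM abelian fourfolds ALL of `k`-signature `(2,2)`
(`#{s ∈ Φ_j | s ∘ i = τ} = 2`); `Aut(ℂ)` `2`-transitive on the four embeddings of `K` over `τ` (`h2T`; Dodson: automatic when one
`A_j` is simple — next theorem); `E ⊨ (k; Ψ)` with `τ ∈ Ψ`.  Then every `C` dominated by `E^a × ⨁_j A_j` satisfies the Hodge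
conjecture, GIVEN ONLY Markman's fourfold theorem. [cite: Markman2025SurveySecant, Thm. 1.2] [cite: Dodson1984, §3.3.2 Theorem]
[cite: Shimura1998, §6.1 Thm. 2 Cor.] [cite: Pohlmann1968, Thm 1] [cite: MumfordAV1970, §19] -/
theorem hodgeConjectureFor_of_avDominatedBy_family_of_markman
    (hW4 : Markman2025_weilClasses_algebraic_abelianFourfold)
    (h8 : Module.finrank ℚ K = 8) (h2 : Module.finrank ℚ k = 2) (i : k →+* K)
    (hA : ∀ j, IsCMTypeRealisation (Φ j) (A j) (ι j) (θ j)) {τ : k →+* ℂ}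
    (h22 : ∀ j, (Finset.univ.filter fun s : K →+* ℂ => s.comp i = τ ∧ s ∈ (Φ j).1).card = 2) (j₀ : Fin n)
    (h2T : ∀ s t s' t' : K →+* ℂ, s.comp i = τ → t.comp i = τ → s'.comp i = τ → t'.comp i = τ → s ≠ t → s' ≠ t' →
      ∃ ρ : ℂ ≃+* ℂ, (ρ : ℂ →+* ℂ).comp s = s' ∧ (ρ : ℂ →+* ℂ).comp t = t')
    (hE : IsCMTypeRealisation Ψ E ιE θE) (hτΨ : τ ∈ Ψ.1) (a : ℕ)
    {C : AbelianVariety ℂ} (hC : AVDominatedBy C ((⨁ fun _ : Fin a => E).prod (⨁ A))) :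
    HodgeConjectureFor C.dim C.X := by
  have hττ : ComplexEmbedding.conjugate τ ≠ τ := QuarticCM.conjugate_ne τ
  have hk : ∀ σ : k →+* ℂ, σ = τ ∨ σ = ComplexEmbedding.conjugate τ := fun σ =>
    QuarticCM.eq_or_eq_conjugate_of_quadratic h2 τ σ
  -- a frame of `Φ_{j₀}` (read as `I_0`), the two further star types and their realisations
  obtain ⟨e, he_sign, he_conj, hΦ₀⟩ := exists_frame₂ h8 h2 i hττ hk (Φ j₀) (h22 j₀)
  have hr₁ : ∀ s, s ∈ (Φ j₀).1 ↔ (e s).2 = signTab 0 0 (e s).1 := fun s => by rw [hΦ₀ s, inr_mem_phi₂_iff_signTab]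
  obtain ⟨Φ₂, hr₂⟩ := exists_cmType_of_frame he_conj 1
  obtain ⟨Φ₃, hr₃⟩ := exists_cmType_of_frame he_conj 2
  obtain ⟨B₂, ι₂, θ₂, hB₂⟩ := cmAbelianVarietyRealised_holds K Φ₂
  obtain ⟨B₃, ι₃, θ₃, hB₃⟩ := cmAbelianVarietyRealised_holds K Φ₃
  obtain ⟨h22₁, h₁₂⟩ := counts_of_frame he_sign (show (0 : Fin 3) ≠ 1 by decide) hr₁ hr₂
  obtain ⟨h22₂, h₂₃⟩ := counts_of_frame he_sign (show (1 : Fin 3) ≠ 2 by decide) hr₂ hr₃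
  obtain ⟨h22₃, -⟩ := counts_of_frame he_sign (show (2 : Fin 3) ≠ 0 by decide) hr₃ hr₁
  obtain ⟨-, h₁₃⟩ := counts_of_frame he_sign (show (0 : Fin 3) ≠ 2 by decide) hr₁ hr₃
  -- the reference family `Bv = (A j₀, B₂, B₃)` read straight in slots `0, 1, 2`
  let Bv : Fin 3 → AbelianVariety ℂ := ![A j₀, B₂, B₃]
  have hdomB : ∀ j, ∃ m : Fin 3, AVDominatedBy (A j) (Bv m) := by
    intro j
    obtain ⟨m, f, hmf⟩ := exists_slot_reading he_sign he_conj (Φ j) (h22 j)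
    refine ⟨m, ?_⟩
    match m with
    | 0 => exact avDominatedBy_of_readings he_conj hmf hr₁ (hA j) (hA j₀)
    | 1 => exact avDominatedBy_of_readings he_conj hmf hr₂ (hA j) hB₂
    | 2 => exact avDominatedBy_of_readings he_conj hmf hr₃ (hA j) hB₃
  choose m hm using hdomB
  -- domination of `E^a × ⨁ A` by a product of copies of `E, A j₀, B₂, B₃`
  let Y : Fin 4 → AbelianVariety ℂ := ![E, A j₀, B₂, B₃]
  have hYsucc : ∀ m : Fin 3, Y m.succ = Bv m := fun m => rfl
  have h₁ : AVDominatedBy (⨁ fun _ : Fin a => E) (⨁ fun _ : Fin a => Y 0) :=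
    AVDominatedBy.biproduct_map fun _ => AVDominatedBy.refl E
  have h₂ : AVDominatedBy (⨁ A) (⨁ fun j => Y (m j).succ) :=
    AVDominatedBy.biproduct_map fun j => by rw [hYsucc]; exact hm j
  have h₁₂' := avDominatedBy_prod_of_biproduct h₁ h₂
  let κ' : Fin a ⊕ Fin n → Fin 4 := Sum.elim (fun _ => 0) fun j => (m j).succ
  have hfam : sumFam (fun _ : Fin a => Y 0) (fun j => Y (m j).succ) = Y ∘ κ' := funext fun x => by
    cases x <;> rfl
  rw [hfam] at h₁₂'
  have hdom := avDominatedBy_biproduct_reindex finSumFinEquiv.symm h₁₂'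
  exact Domination.hodgeConjectureFor_of_avDominatedBy
    (hodgeConjectureFor_biproduct_comp_vec_of_markman₃ hW4 h8 h2 i (hA j₀) hB₂ hB₃ hE hτΨ h22₁ h22₂ h22₃ h₁₂ h₁₃ h₂₃ h2T
      (κ' ∘ finSumFinEquiv.symm)) (hC.trans hdom)

/-- **THE GALOIS ORBIT OF A DEGENERATE SIMPLE CM FOURFOLD: the Hodge conjecture for `E^a × ∏_j A_j` and everything it
dominates, GIVEN ONLY Markman's fourfold theorem.**  `K` ANY CM field of degree `8`, `k` imaginary quadratic, `i : k → K`,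
`τ : k → ℂ`; `A_j ⊨ (K; Φ_j)` (`j < n`) CM abelian fourfolds ALL of `k`-signature `(2,2)` (`#{s ∈ Φ_j | s ∘ i = τ} = 2`: abelian
fourfolds of Weil type for `k` with CM by `K` — e.g. all Galois conjugates `σB`, with any CM structures, of one of them), `A_{j₀}`
SIMPLE (Dodson: `Gal(Kᶜ/ℚ) ≅ ℤ₂ × A₄` or `ℤ₂ × S₄`), `E ⊨ (k; Ψ)` with `τ ∈ Ψ`.  Then every `C` dominated by `E^a × ⨁_j A_j`
(isogeny factors, quotients, abelian subvarieties, the product itself) satisfies the Hodge conjecture.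
[cite: Markman2025SurveySecant, Thm. 1.2] [cite: Dodson1984, §3.3.2 Theorem] [cite: Shimura1998, §6.1 Thm. 2 Cor. and §8.2 Prop. 26]
[cite: Pohlmann1968, Thm 1 and §3] [cite: MumfordAV1970, §19] -/
theorem hodgeConjectureFor_of_avDominatedBy_family_of_isSimple_of_markman
    (hW4 : Markman2025_weilClasses_algebraic_abelianFourfold)
    (h8 : Module.finrank ℚ K = 8) (h2 : Module.finrank ℚ k = 2) (i : k →+* K)
    (hA : ∀ j, IsCMTypeRealisation (Φ j) (A j) (ι j) (θ j)) {τ : k →+* ℂ}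
    (h22 : ∀ j, (Finset.univ.filter fun s : K →+* ℂ => s.comp i = τ ∧ s ∈ (Φ j).1).card = 2)
    {j₀ : Fin n} (hS : (A j₀).IsSimple) (hE : IsCMTypeRealisation Ψ E ιE θE) (hτΨ : τ ∈ Ψ.1) (a : ℕ)
    {C : AbelianVariety ℂ} (hC : AVDominatedBy C ((⨁ fun _ : Fin a => E).prod (⨁ A))) :
    HodgeConjectureFor C.dim C.X :=
  hodgeConjectureFor_of_avDominatedBy_family_of_markman hW4 h8 h2 i hA h22 j₀
    (twoTransitive_of_isSimple h8 h2 i (hA j₀) hS τ (h22 j₀)) hE hτΨ a hC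

/-- **… in particular for `E^a × ∏_j A_j` itself** (every rational `(q,q)`-class on the product of any finite family of
`(2,2)`-type CM fourfolds over `K`, one of them simple, and any power of the CM curve of `k`, is algebraic — modulo Markman's
fourfold theorem). [cite: Markman2025SurveySecant, Thm. 1.2] [cite: Dodson1984, §3.3.2 Theorem] [cite: Pohlmann1968, Thm 1] -/
theorem hodgeConjectureFor_family_of_isSimple_of_markman
    (hW4 : Markman2025_weilClasses_algebraic_abelianFourfold)
    (h8 : Module.finrank ℚ K = 8) (h2 : Module.finrank ℚ k = 2) (i : k →+* K)
    (hA : ∀ j, IsCMTypeRealisation (Φ j) (A j) (ι j) (θ j)) {τ : k →+* ℂ}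
    (h22 : ∀ j, (Finset.univ.filter fun s : K →+* ℂ => s.comp i = τ ∧ s ∈ (Φ j).1).card = 2)
    {j₀ : Fin n} (hS : (A j₀).IsSimple) (hE : IsCMTypeRealisation Ψ E ιE θE) (hτΨ : τ ∈ Ψ.1) (a : ℕ) :
    HodgeConjectureFor ((⨁ fun _ : Fin a => E).prod (⨁ A)).dim ((⨁ fun _ : Fin a => E).prod (⨁ A)).X :=
  hodgeConjectureFor_of_avDominatedBy_family_of_isSimple_of_markman hW4 h8 h2 i hA h22 hS hE hτΨ a
    (AVDominatedBy.refl _)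

/-- **The fourfolds alone: the Hodge conjecture for `∏_j A_j`** — every finite product of CM abelian fourfolds of Weil type
(`k`-signature `(2,2)` for some imaginary quadratic `k ⊂ K`) with CM by ONE octic CM field `K`, one of them simple; e.g.
`B × σB × σ'B × …` for a degenerate simple CM fourfold `B` and its Galois conjugates — modulo Markman's fourfold theorem (no
curve in the statement: the CM curve of `k` exists by the tree's `cmAbelianVarietyRealised_holds`).
[cite: Markman2025SurveySecant, Thm. 1.2] [cite: Dodson1984, §3.3.2 Theorem] [cite: Shimura1998, §6.1 Thm. 2 Cor., §6.2 Thm. 3] -/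
theorem hodgeConjectureFor_biproduct_family_of_isSimple_of_markman
    (hW4 : Markman2025_weilClasses_algebraic_abelianFourfold)
    (h8 : Module.finrank ℚ K = 8) (h2 : Module.finrank ℚ k = 2) (i : k →+* K)
    (hA : ∀ j, IsCMTypeRealisation (Φ j) (A j) (ι j) (θ j)) {τ : k →+* ℂ}
    (h22 : ∀ j, (Finset.univ.filter fun s : K →+* ℂ => s.comp i = τ ∧ s ∈ (Φ j).1).card = 2)
    {j₀ : Fin n} (hS : (A j₀).IsSimple) :
    HodgeConjectureFor (⨁ A).dim (⨁ A).X := by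
  -- the CM curve of `k` exists (Shimura §6.2 Thm. 3, tree theorem); take `a = 0` copies of it
  obtain ⟨E, ιE, θE, hE⟩ := cmAbelianVarietyRealised_holds k (CMTypeCount.single h2 τ)
  exact hodgeConjectureFor_of_avDominatedBy_family_of_isSimple_of_markman hW4 h8 h2 i hA h22 hS hE
    (show τ ∈ (CMTypeCount.single h2 τ).1 by rw [CMTypeCount.single_val]; rfl) 0
    ⟨AbelianVariety.prodLift 0 (𝟙 _), AbelianVariety.snd _ _, 1, one_ne_zero, by
      rw [AbelianVariety.prodLift_snd, one_smul]⟩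

end Main

end Summit.HodgeConjecture.CorCM.OcticWeilOrbit

end
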